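import Summits.RiemannHypothesis.RiemannHypothesis.Theorems.PfPersistenceParityTransfer
import Summits.RiemannHypothesis.RiemannHypothesis.Theorems.PfPersistenceGalerkinCutoffProfile
import Summits.RiemannHypothesis.RiemannHypothesis.Theorems.PfPersistencePrimeDialMatching
import HarnessLib

/-!
# PF persistence — the ODD BLOCK of the truncated Weil form is an affine image of the EVEN BLOCK
# (pub-rhpf, cand-6 gen 5; leaf G1.05eo-ORDER; helper for item stmt-RiemannHypothesis-19953)

**HONEST FRAMING. This is a long-odds MECHANISM SEARCH; no RH claims.** RH-free, sorry-free linear algebra and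
calculus about the cell's observatory records; nothing here bears on the truth of RH.

* §1 LINEARITY of Weil's functional `weil L w = W_{0,2} − W_R − Σ_p W_p` on `C¹` pattern functions (the
  archimedean integrand `(Θ e^{y/2} − Θ(0))/sinh y` is integrable for `C¹` `Θ`, tree lemma
  `integrableOn_div_sinh_Ioc`).
* §2 THE PARITY DICTIONARY, pointwise in the lag: for `n, m ≥ 1`
  `θ⁻_{nm}(y) = (m/n) · (θ⁺_{nm}(y) − √2 · θ⁺_{0m}(y))` (`thetaOdd_eq_thetaEven`).
* §3 Hence for EVERY weight table `w` and EVERY window: the odd block `oddBlock w win` (modes `1 … N`) is the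
  entrywise image `M_{ij} = ((j+1)/(i+1)) (P_{ij} − √2 b_j)` of the even block's body `P` and border `b`
  (`oddBlock_eq_oddOfEven`), i.e. `M = Ω⁻¹ (P − √2·𝟙 bᵀ) Ω`: THE ODD SPECTRUM IS THE SPECTRUM OF THE
  BORDER-DEFLATED EVEN BODY (`exists_oddEigen_iff`); both blocks are symmetric (`evenBlock_isSymm`,
  `oddBlock_isSymm`).
* §4 READER CLOSURE: every two-parity reader of finitely many windows (order bit `sign(ε₁^odd − ε₁^even)`, odd
  sign, two-parity index) is a reader of those windows' EVEN blocks, so the cell's finite-window closure applies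
  verbatim (`FactorsThrough.not_separates_of_twoParity`, from `FactorsThrough.not_separates_of_windowsAffine`).

All statements are about the finite sections of an arbitrary weight table; `[folklore]` throughout (Connes–Consani,
arXiv:2106.01715, Lemma 2.6 for the pattern functions).
-/

set_option linter.dupNamespace false  -- the mandated namespace repeats `RiemannHypothesis`

noncomputable section

open Real Finset Matrix MeasureTheory intervalIntegral Set

namespace Summit.RiemannHypothesis.RiemannHypothesis.Theorems.PfPersistence

open Summit.RiemannHypothesis.RiemannHypothesis.Theorems.PfPersistenceParityTransfer (thetaOdd ParityPair
  thetaOdd_displacement thetaEven_border cast_sq_sub_sq_ne_zero)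

/-! ## §1 Linearity of Weil's functional on `C¹` pattern functions -/

/-- PROVED: `W_{0,2}` is additive on continuous functions. [folklore] -/
theorem W02_add (L : ℝ) {Θ₁ Θ₂ : ℝ → ℝ} (h₁ : Continuous Θ₁) (h₂ : Continuous Θ₂) :
    W02 L (fun y => Θ₁ y + Θ₂ y) = W02 L Θ₁ + W02 L Θ₂ := by
  unfold W02
  have i₁ : IntervalIntegrable (fun y => Θ₁ y * Real.cosh (y / 2)) volume 0 L :=
    (h₁.mul (by fun_prop)).intervalIntegrable _ _
  have i₂ : IntervalIntegrable (fun y => Θ₂ y * Real.cosh (y / 2)) volume 0 L :=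
    (h₂.mul (by fun_prop)).intervalIntegrable _ _
  simp_rw [add_mul]
  rw [intervalIntegral.integral_add i₁ i₂]
  ring

/-- PROVED: `W_{0,2}(Θ · c) = W_{0,2}(Θ) · c`. [folklore] -/
theorem W02_mul_const (L c : ℝ) (Θ : ℝ → ℝ) : W02 L (fun y => Θ y * c) = W02 L Θ * c := by
  unfold W02
  have : (fun y => Θ y * c * Real.cosh (y / 2)) = fun y => Θ y * Real.cosh (y / 2) * c := by
    funext y; ring
  rw [this, intervalIntegral.integral_mul_const]
  ring

/-- PROVED: `W_R` is additive on `C¹` functions (each integrand `(Θ e^{y/2} − Θ(0))/sinh y` is integrable on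
`(0, L]`, `integrableOn_div_sinh_Ioc`). [folklore] -/
theorem WR_add {L : ℝ} (hL : 0 ≤ L) {Θ₁ Θ₂ : ℝ → ℝ} (h₁ : ContDiff ℝ 1 Θ₁) (h₂ : ContDiff ℝ 1 Θ₂) :
    WR L (fun y => Θ₁ y + Θ₂ y) = WR L Θ₁ + WR L Θ₂ := by
  unfold WR
  have hint : ∀ {Θ : ℝ → ℝ}, ContDiff ℝ 1 Θ →
      IntervalIntegrable (fun y => (Θ y * Real.exp (y / 2) - Θ 0) / Real.sinh y) volume 0 L := by
    intro Θ hΘ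
    exact intervalIntegrable_div_sinh ((hΘ.mul (by fun_prop)).sub contDiff_const) (by simp) hL
  have hpt : (fun y => ((Θ₁ y + Θ₂ y) * Real.exp (y / 2) - (Θ₁ 0 + Θ₂ 0)) / Real.sinh y)
      = fun y => (Θ₁ y * Real.exp (y / 2) - Θ₁ 0) / Real.sinh y
          + (Θ₂ y * Real.exp (y / 2) - Θ₂ 0) / Real.sinh y := by
    funext y; rw [← add_div]; ring
  rw [hpt, intervalIntegral.integral_add (hint h₁) (hint h₂)]
  ring

/-- PROVED: `W_R(Θ · c) = W_R(Θ) · c`. [folklore] -/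
theorem WR_mul_const (L c : ℝ) (Θ : ℝ → ℝ) : WR L (fun y => Θ y * c) = WR L Θ * c := by
  unfold WR
  have : (fun y => (Θ y * c * Real.exp (y / 2) - Θ 0 * c) / Real.sinh y)
      = fun y => (Θ y * Real.exp (y / 2) - Θ 0) / Real.sinh y * c := by
    funext y; ring
  rw [this, intervalIntegral.integral_mul_const]
  ring

/-- PROVED: the prime part is additive in the test function (finite sum). [folklore] -/
theorem WP_add' (L : ℝ) (w : Weights) (Θ₁ Θ₂ : ℝ → ℝ) :
    WP L w (fun y => Θ₁ y + Θ₂ y) = WP L w Θ₁ + WP L w Θ₂ := by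
  unfold WP
  rw [← mul_add, ← Finset.sum_add_distrib]
  congr 1
  exact Finset.sum_congr rfl fun q _ => by ring

/-- PROVED: `W_P(Θ · c) = W_P(Θ) · c`. [folklore] -/
theorem WP_mul_const' (L c : ℝ) (w : Weights) (Θ : ℝ → ℝ) :
    WP L w (fun y => Θ y * c) = WP L w Θ * c := by
  unfold WP
  rw [mul_assoc, Finset.sum_mul]
  congr 1
  exact Finset.sum_congr rfl fun q _ => by ring

/-- **PROVED — ADDITIVITY of Weil's functional** on `C¹` functions (`0 ≤ L`). [folklore] -/
theorem weil_add {L : ℝ} (hL : 0 ≤ L) (w : Weights) {Θ₁ Θ₂ : ℝ → ℝ} (h₁ : ContDiff ℝ 1 Θ₁)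
    (h₂ : ContDiff ℝ 1 Θ₂) : weil L w (fun y => Θ₁ y + Θ₂ y) = weil L w Θ₁ + weil L w Θ₂ := by
  unfold weil
  rw [W02_add L h₁.continuous h₂.continuous, WR_add hL h₁ h₂, WP_add']
  ring

/-- **PROVED — HOMOGENEITY of Weil's functional**: `W(Θ · c) = W(Θ) · c` (no hypothesis). [folklore] -/
theorem weil_mul_const (L c : ℝ) (w : Weights) (Θ : ℝ → ℝ) :
    weil L w (fun y => Θ y * c) = weil L w Θ * c := by
  unfold weil
  rw [W02_mul_const, WR_mul_const, WP_mul_const']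
  ring

/-- PROVED: `W(Θ₁ · c₁ + Θ₂ · c₂) = W(Θ₁) c₁ + W(Θ₂) c₂` on `C¹` functions. [folklore] -/
theorem weil_lincomb {L : ℝ} (hL : 0 ≤ L) (w : Weights) {Θ₁ Θ₂ : ℝ → ℝ} (h₁ : ContDiff ℝ 1 Θ₁)
    (h₂ : ContDiff ℝ 1 Θ₂) (c₁ c₂ : ℝ) :
    weil L w (fun y => Θ₁ y * c₁ + Θ₂ y * c₂) = weil L w Θ₁ * c₁ + weil L w Θ₂ * c₂ := by
  have e := weil_add hL w (Θ₁ := fun y => Θ₁ y * c₁) (Θ₂ := fun y => Θ₂ y * c₂)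
    (h₁.mul contDiff_const) (h₂.mul contDiff_const)
  simpa only [weil_mul_const] using e

/-! ## §2 The parity dictionary, pointwise in the lag -/

/-- PROVED: the odd pattern functions are `C¹`. [folklore] -/
theorem contDiff_thetaOdd (L : ℝ) (n m : ℕ) : ContDiff ℝ 1 (thetaOdd L n m) := by
  by_cases hnm : n = m
  · have : thetaOdd L n m = fun y =>
        (L - y) / L * Real.cos (2 * π * n * y / L) + Real.sin (2 * π * n * y / L) / (2 * π * n) := by
      funext y; simp [thetaOdd, hnm]
    rw [this]; fun_prop
  · have : thetaOdd L n m = fun y =>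
        ((m : ℝ) * Real.sin (2 * π * n * y / L) - (n : ℝ) * Real.sin (2 * π * m * y / L)) /
          (π * ((m : ℝ) ^ 2 - (n : ℝ) ^ 2)) := by
      funext y; simp [thetaOdd, hnm]
    rw [this]; fun_prop

/-- **PROVED — THE PARITY DICTIONARY (pointwise):** for `n, m ≥ 1` and every lag `y`,
`θ⁻_{nm}(y) = (m/n) · (θ⁺_{nm}(y) − √2 · θ⁺_{0m}(y))`: the odd correlation function is an explicit combination
of the even BODY entry and the even BORDER entry of the same column. [folklore] -/
theorem thetaOdd_eq_thetaEven (L : ℝ) {n m : ℕ} (hn : n ≠ 0) (hm : m ≠ 0) (y : ℝ) :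
    thetaOdd L n m y = ((m : ℝ) / n) * (thetaEven L n m y - Real.sqrt 2 * thetaEven L 0 m y) := by
  have hπ : (π : ℝ) ≠ 0 := Real.pi_ne_zero
  have hn' : (n : ℝ) ≠ 0 := by exact_mod_cast hn
  have hm' : (m : ℝ) ≠ 0 := by exact_mod_cast hm
  have h2 : Real.sqrt 2 ≠ 0 := by positivity
  -- the border entry `θ⁺_{0m}(y) = -sin(ω_m y)/(√2 π m)`; `√2 · θ⁺_{0m}(y) = -sin(ω_m y)/(π m)`
  have hb : Real.sqrt 2 * thetaEven L 0 m y = -Real.sin (2 * π * m * y / L) / (π * m) := by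
    have e : thetaEven L 0 m y = -Real.sin (2 * π * m * y / L) / (Real.sqrt 2 * π * m) := by
      simp [thetaEven, hm]
    rw [e, mul_assoc (Real.sqrt 2) π (m : ℝ), ← mul_div_assoc, mul_div_mul_left _ _ h2]
  rw [hb]
  by_cases hnm : n = m
  · subst hnm
    set sn := Real.sin (2 * π * n * y / L) with hsn
    set cn := Real.cos (2 * π * n * y / L) with hcn
    have e1 : thetaOdd L n n y = (L - y) / L * cn + sn / (2 * π * n) := by simp [thetaOdd, hsn, hcn]
    have e2 : thetaEven L n n y = (L - y) / L * cn - sn / (2 * π * n) := by simp [thetaEven, hn, hsn, hcn]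
    rw [e1, e2]
    field_simp
    ring
  · have hd := cast_sq_sub_sq_ne_zero hnm hm
    set sn := Real.sin (2 * π * n * y / L) with hsn
    set sm := Real.sin (2 * π * m * y / L) with hsm
    have e1 : thetaOdd L n m y = ((m : ℝ) * sn - (n : ℝ) * sm) / (π * ((m : ℝ) ^ 2 - (n : ℝ) ^ 2)) := by
      simp [thetaOdd, hnm, hsn, hsm]
    have e2 : thetaEven L n m y = ((n : ℝ) * sn - (m : ℝ) * sm) / (π * ((m : ℝ) ^ 2 - (n : ℝ) ^ 2)) := by
      simp [thetaEven, hn, hm, hnm, hsn, hsm]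
    rw [e1, e2]
    field_simp
    ring

/-- PROVED: the even pattern functions are symmetric in `(n, m)`. [folklore] -/
theorem thetaEven_symm (L : ℝ) (n m : ℕ) : thetaEven L n m = thetaEven L m n := by
  funext y
  by_cases hn : n = 0
  · by_cases hm : m = 0
    · subst hn; subst hm; rfl
    · simp [thetaEven, hn, hm]
  · by_cases hm : m = 0
    · simp [thetaEven, hn, hm]
    · by_cases hnm : n = m
      · subst hnm; rfl
      · have h1 := mul_ne_zero Real.pi_ne_zero (cast_sq_sub_sq_ne_zero hnm hm)
        have h2 := mul_ne_zero Real.pi_ne_zero (cast_sq_sub_sq_ne_zero (Ne.symm hnm) hn)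
        simp only [thetaEven, hn, hm, hnm, Ne.symm hnm, and_self, if_false]
        rw [div_eq_div_iff h1 h2]
        ring

/-- PROVED: the odd pattern functions are symmetric in `(n, m)`. [folklore] -/
theorem thetaOdd_symm (L : ℝ) (n m : ℕ) : thetaOdd L n m = thetaOdd L m n := by
  funext y
  by_cases hnm : n = m
  · subst hnm; rfl
  · by_cases hm : m = 0
    · subst hm
      simp only [thetaOdd, hnm, Ne.symm hnm, if_false, Nat.cast_zero]
      ring
    · by_cases hn : n = 0
      · subst hn
        simp only [thetaOdd, hnm, Ne.symm hnm, if_false, Nat.cast_zero]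
        ring
      · have h1 := mul_ne_zero Real.pi_ne_zero (cast_sq_sub_sq_ne_zero hnm hm)
        have h2 := mul_ne_zero Real.pi_ne_zero (cast_sq_sub_sq_ne_zero (Ne.symm hnm) hn)
        simp only [thetaOdd, hnm, Ne.symm hnm, if_false]
        rw [div_eq_div_iff h1 h2]
        ring

/-! ## §3 The odd block of a weight table is an affine image of its even block -/

/-- The ODD BLOCK at window `win` of the weight table `w`: `(i, j) ↦ W(θ⁻_{i+1, j+1})` with `L = 2a`, on the odd
modes `1 … N` (companion of `evenBlock`; the `M` of a `ParityPair`). [folklore] -/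
def oddBlock (w : Weights) (win : Window) : Matrix (Fin win.N) (Fin win.N) ℝ :=
  fun i j => weil (2 * win.a) w (thetaOdd (2 * win.a) ((i : ℕ) + 1) ((j : ℕ) + 1))

/-- The BORDER-DEFLATED BODY of an `(N+1) × (N+1)` matrix `E`: `(i, j) ↦ E_{i+1, j+1} − √2 · E_{0, j+1}`
(body minus `√2 ·` the border row, i.e. `P − √2 · 𝟙 bᵀ`). [folklore] -/
def deflatedBody {N : ℕ} (E : Matrix (Fin (N + 1)) (Fin (N + 1)) ℝ) : Matrix (Fin N) (Fin N) ℝ :=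
  fun i j => E i.succ j.succ - Real.sqrt 2 * E 0 j.succ

/-- THE AFFINE IMAGE `E ↦ Ω⁻¹ (P − √2 · 𝟙 bᵀ) Ω`, `Ω = diag(1, …, N)`:
`(i, j) ↦ ((j+1)/(i+1)) · (E_{i+1, j+1} − √2 · E_{0, j+1})`. [folklore] -/
def oddOfEven {N : ℕ} (E : Matrix (Fin (N + 1)) (Fin (N + 1)) ℝ) : Matrix (Fin N) (Fin N) ℝ :=
  fun i j => (((j : ℕ) + 1 : ℕ) : ℝ) / (((i : ℕ) + 1 : ℕ) : ℝ) * deflatedBody E i j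

/-- **PROVED — THE ODD BLOCK IS AN AFFINE IMAGE OF THE EVEN BLOCK**, for every weight table and every window:
`oddBlock w win = oddOfEven (evenBlock w win)`, entrywise `M_{ij} = ((j+1)/(i+1)) (P_{ij} − √2 b_j)`. [folklore] -/
theorem oddBlock_eq_oddOfEven (w : Weights) (win : Window) : oddBlock w win = oddOfEven (evenBlock w win) := by
  ext i j
  have hL : 0 ≤ 2 * win.a := by linarith [win.ha]
  have hfun : thetaOdd (2 * win.a) ((i : ℕ) + 1) ((j : ℕ) + 1) = fun y =>
      thetaEven (2 * win.a) ((i : ℕ) + 1) ((j : ℕ) + 1) y * ((((j : ℕ) + 1 : ℕ) : ℝ) / (((i : ℕ) + 1 : ℕ) : ℝ))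
        + thetaEven (2 * win.a) 0 ((j : ℕ) + 1) y *
          (-(Real.sqrt 2 * ((((j : ℕ) + 1 : ℕ) : ℝ) / (((i : ℕ) + 1 : ℕ) : ℝ)))) := by
    funext y
    rw [thetaOdd_eq_thetaEven _ (Nat.succ_ne_zero _) (Nat.succ_ne_zero _)]
    ring
  have e1 : evenBlock w win i.succ j.succ =
      weil (2 * win.a) w (thetaEven (2 * win.a) ((i : ℕ) + 1) ((j : ℕ) + 1)) := by
    simp [evenBlock, Fin.val_succ]
  have e2 : evenBlock w win 0 j.succ = weil (2 * win.a) w (thetaEven (2 * win.a) 0 ((j : ℕ) + 1)) := by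
    simp [evenBlock, Fin.val_succ]
  simp only [oddOfEven, deflatedBody, oddBlock]
  rw [e1, e2, hfun, weil_lincomb hL w (contDiff_thetaEven _ _ _) (contDiff_thetaEven _ _ _)]
  ring

/-- PROVED: the even block is symmetric. [folklore] -/
theorem evenBlock_isSymm (w : Weights) (win : Window) : (evenBlock w win).IsSymm :=
  Matrix.IsSymm.ext fun i j => by
    simp only [evenBlock]
    rw [thetaEven_symm]

/-- PROVED: the odd block is symmetric. [folklore] -/
theorem oddBlock_isSymm (w : Weights) (win : Window) : (oddBlock w win).IsSymm :=
  Matrix.IsSymm.ext fun i j => by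
    simp only [oddBlock]
    rw [thetaOdd_symm]

/-- the diagonal frequency scaling `(Ω u)_j = (j+1) u_j`. [folklore] -/
def scaleUp {N : ℕ} (u : Fin N → ℝ) : Fin N → ℝ := fun j => (((j : ℕ) + 1 : ℕ) : ℝ) * u j

/-- its inverse `(Ω⁻¹ v)_j = v_j/(j+1)`. [folklore] -/
def scaleDown {N : ℕ} (v : Fin N → ℝ) : Fin N → ℝ := fun j => v j / (((j : ℕ) + 1 : ℕ) : ℝ)

/-- PROVED: `Ω (Ω⁻¹ v) = v`. [folklore] -/
theorem scaleUp_scaleDown {N : ℕ} (v : Fin N → ℝ) : scaleUp (scaleDown v) = v := by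
  funext j
  have hj : ((((j : ℕ) + 1 : ℕ) : ℝ)) ≠ 0 := by positivity
  simp only [scaleUp, scaleDown]
  field_simp

/-- PROVED: `Ω u ≠ 0` for `u ≠ 0`. [folklore] -/
theorem scaleUp_ne_zero {N : ℕ} {u : Fin N → ℝ} (hu : u ≠ 0) : scaleUp u ≠ 0 := by
  intro h
  apply hu
  funext j
  have hj : ((((j : ℕ) + 1 : ℕ) : ℝ)) ≠ 0 := by positivity
  have := congrFun h j
  simp only [scaleUp, Pi.zero_apply, mul_eq_zero] at this
  exact this.resolve_left hj

/-- PROVED: `(oddOfEven E · u)_i = ((P − √2 𝟙bᵀ)(Ω u))_i / (i+1)`. [folklore] -/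
theorem oddOfEven_mulVec {N : ℕ} (E : Matrix (Fin (N + 1)) (Fin (N + 1)) ℝ) (u : Fin N → ℝ) (i : Fin N) :
    (oddOfEven E *ᵥ u) i = (deflatedBody E *ᵥ scaleUp u) i / (((i : ℕ) + 1 : ℕ) : ℝ) := by
  simp only [Matrix.mulVec, dotProduct, oddOfEven, scaleUp]
  rw [Finset.sum_div]
  exact Finset.sum_congr rfl fun j _ => by ring

/-- **PROVED (SIMILARITY).** `u` is an eigenvector of the affine image `oddOfEven E` with eigenvalue `μ` iff
`Ω u` is an eigenvector of the border-deflated body `P − √2 · 𝟙 bᵀ` with eigenvalue `μ`. [folklore] -/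
theorem oddOfEven_mulVec_eq_smul_iff {N : ℕ} (E : Matrix (Fin (N + 1)) (Fin (N + 1)) ℝ) (μ : ℝ)
    (u : Fin N → ℝ) : oddOfEven E *ᵥ u = μ • u ↔ deflatedBody E *ᵥ scaleUp u = μ • scaleUp u := by
  constructor
  · intro h
    funext i
    have hi : ((((i : ℕ) + 1 : ℕ) : ℝ)) ≠ 0 := by positivity
    have := congrFun h i
    rw [oddOfEven_mulVec, Pi.smul_apply, smul_eq_mul, div_eq_iff hi] at this
    simp only [Pi.smul_apply, smul_eq_mul, scaleUp]
    linear_combination this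
  · intro h
    funext i
    have hi : ((((i : ℕ) + 1 : ℕ) : ℝ)) ≠ 0 := by positivity
    have := congrFun h i
    simp only [Pi.smul_apply, smul_eq_mul, scaleUp] at this
    rw [oddOfEven_mulVec, Pi.smul_apply, smul_eq_mul, div_eq_iff hi]
    linear_combination this

/-- **PROVED — THE ODD SPECTRUM IS THE SPECTRUM OF THE BORDER-DEFLATED EVEN BODY.** For every weight table and
window, `μ` is an eigenvalue of `oddBlock w win` iff it is an eigenvalue of `deflatedBody (evenBlock w win)`
`= P − √2 · 𝟙 bᵀ` (a rank-one perturbation of the even body; NOT symmetric in general). [folklore] -/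
theorem exists_oddEigen_iff (w : Weights) (win : Window) (μ : ℝ) :
    (∃ u : Fin win.N → ℝ, u ≠ 0 ∧ oddBlock w win *ᵥ u = μ • u) ↔
      ∃ v : Fin win.N → ℝ, v ≠ 0 ∧ deflatedBody (evenBlock w win) *ᵥ v = μ • v := by
  rw [oddBlock_eq_oddOfEven]
  constructor
  · rintro ⟨u, hu, h⟩
    exact ⟨scaleUp u, scaleUp_ne_zero hu, (oddOfEven_mulVec_eq_smul_iff _ μ u).1 h⟩
  · rintro ⟨v, hv, h⟩
    refine ⟨scaleDown v, fun h0 => hv ?_, (oddOfEven_mulVec_eq_smul_iff _ μ _).2 (by rwa [scaleUp_scaleDown])⟩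
    rw [← scaleUp_scaleDown v, h0]
    funext j
    simp [scaleUp]

/-! ## §4 Reader closure: two-parity readers are even-block readers -/

/-- The odd block READ OFF A DATUM through the affine image (`= oddBlock w win` on weight-table data,
`oddDatum_datumOf`). [folklore] -/
def oddDatum (d : Datum) (win : Window) : Matrix (Fin win.N) (Fin win.N) ℝ := oddOfEven (d win)

/-- PROVED: on the datum of a weight table the read-off odd block is the true odd block. [folklore] -/
theorem oddDatum_datumOf (w : Weights) (win : Window) : oddDatum (datumOf w) win = oddBlock w win :=
  (oddBlock_eq_oddOfEven w win).symm

/-- PROVED: weight tables with the same even block at a window have the same odd block there. [folklore] -/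
theorem oddBlock_eq_of_evenBlock_eq {w w' : Weights} {win : Window} (h : evenBlock w win = evenBlock w' win) :
    oddBlock w win = oddBlock w' win := by
  rw [oddBlock_eq_oddOfEven, oddBlock_eq_oddOfEven, h]

/-- **PROVED (READER CLOSURE FOR TWO-PARITY READERS).** A class factoring through ANY reader of the two-parity
data (even AND odd blocks — e.g. the order bit `sign(ε₁^odd − ε₁^even)`, the odd sign, the two-parity index)
at finitely many windows and finitely many affine coordinates cannot separate `ζ` on any domain
`⊇ arithDialSpace`: such a reader is a reader of the even blocks at those windows
(`FactorsThrough.not_separates_of_windowsAffine`). [folklore] -/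
theorem FactorsThrough.not_separates_of_twoParity {ι : Type*} [Fintype ι] {ρ : Type} {S : Set Datum}
    {F : Datum → ρ} (hS : FactorsThrough S F) (Φ : Datum →ₗ[ℝ] (ι → ℝ)) (W : Finset Window)
    (hF : ∀ d d' : Datum, Φ d = Φ d' →
      (∀ win ∈ W, d win = d' win ∧ oddDatum d win = oddDatum d' win) → F d = F d')
    {D : Set Datum} (hD : arithDialSpace ⊆ D) : ¬ Separates S D zetaDatum :=
  hS.not_separates_of_windowsAffine Φ W
    (fun d d' hΦ h => hF d d' hΦ fun win hw => ⟨h win hw, by rw [oddDatum, oddDatum, h win hw]⟩) hD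

end Summit.RiemannHypothesis.RiemannHypothesis.Theorems.PfPersistence
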